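import Summits.SmoothPoincare4.SmoothPoincare4.Theorems.SymplecticOrigamiFoldedSphereFoldExistenceImmersionR5Charts
import Literature.Topology.FourManifolds.HomotopyS4FoldMap
import Literature.Topology.FourManifolds.WhitneyModelSheets
import Literature.Topology.FourManifolds.HomotopySpheres
import Mathlib.Geometry.Manifold.PartitionOfUnity

/-!
# Fold maps along a chart sphere, II: the fold map lifts to an immersion `M → ℝ⁴ × ℝ`

Route `SmoothPoincare4/SymplecticOrigami`, support item `FoldedSphereFoldExistence`
(stmt-SmoothPoincare4-14076), closed modulo the named fact
`Literature.Topology.FourManifolds.eliashberg_foldMap_homotopySphere_four`. Gromov, *Partial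
Differential Relations* (1986), §2.1.3 (C″), p. 58, observes that a map `f : V → ℝⁿ` folding
along a normally oriented hypersurface `V'` lifts to an IMMERSION `f ⊕ f₀ : V → ℝⁿ⁺¹` for any
function `f₀` whose derivative does not vanish on the kernel line of `df` along `V'`. We prove
this for the fold maps of the named fact (fold along a chart sphere `Σ = e(S³)`, which is
normally oriented by the inside/outside of the chart ball):

* `sign_consistency_of_signedFoldCharts` — two signed fold charts (part I,
  `exists_signedFoldChart`) induce the same orientation of the kernel line at a common fold
  point;
* `exists_immersion_prodReal_of_foldMap` — **the lift**: `F = (f, λ)` with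
  `λ = Σᵢ ρᵢ · εᵢ (φᵢ)₀` (smooth partition of unity subordinate to signed fold charts and `M ∖ Σ`)
  has injective differential everywhere;
* `exists_immersion_prodReal_of_eliashbergFoldMap` — hence the named fact implies that **every
  smooth homotopy 4-sphere immerses in `ℝ⁴ × ℝ = ℝ⁵`** (also over the tree's `HomotopySphere 4`,
  `exists_immersion_prodReal_homotopySphere_of_eliashbergFoldMap`).

Meaning for the debt (numbers, not adjectives). An immersion `M⁴ ↬ ℝ⁵` of a simply connected
closed `M` has trivial normal line bundle, so `TM ⊕ ℝ ≅ ℝ⁵`: the named fact implies that every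
homotopy 4-sphere is stably parallelisable — Kervaire–Milnor 1963, Thm. 3.1 in dimension 4, whose
printed proofs use the signature theorem / `Ω₄^{SO} ≅ ℤ`, and which the tree carries as an OPEN
hypothesis (`h31` of `Literature.Barriers.SmoothPoincare4.stableBarrierFour_of_kervaireMilnorFrontier`;
`isStablyParallelizable_four_of_sig` is conditional). So the fact — and with it this item's only
recorded closing route — sits above KM 3.1 (n = 4) in the debt order, independently of the
`h`-principle half (Gromov (D)) being formalised in `Literature/Topology/Immersions`.
-/

noncomputable section

-- the prescribed namespace `Summit.<P>.<Sub>.…` duplicates `SmoothPoincare4` (P = Sub)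
set_option linter.dupNamespace false

open scoped Manifold ContDiff Topology
open Set Function Metric

namespace Summit.SmoothPoincare4.SmoothPoincare4.Theorems.FoldedSphereFoldExistence

variable {M : Type*} [TopologicalSpace M] [ChartedSpace (EuclideanSpace ℝ (Fin 4)) M]
  [IsManifold (𝓡 4) ∞ M]

/-! ### Two signed fold charts orient the kernel line the same way -/

/-- **Sign consistency.** Let `(φ, U, ε)` and `(φ', U', ε')` be signed fold charts (as produced
by `exists_signedFoldChart`) at a fold point `x`, and let `v` span the kernel of `df_x`, with
`dφ_x v = e₀`. Then `t ↦ ε' (φ' (φ⁻¹(φ x + t e₀)))₀` has derivative `D` at `0` with `0 < ε D`: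
along the chart line of `φ` the point is outside the ball exactly when `ε t > 0`, where `ε' φ'₀`
is `≥ 0`, so `ε D ≥ 0` (one-sided Fermat); and `D ≠ 0` because `dφ'_x v` is a non-zero multiple
of `e₀` (the kernel line read in the chart `φ'`). [folklore] -/
theorem sign_consistency_of_signedFoldCharts {e : (EuclideanSpace ℝ (Fin 4)) → M} {f : M → (EuclideanSpace ℝ (Fin 4))}
    {φ : OpenPartialHomeomorph M (EuclideanSpace ℝ (Fin 4))} {U : Set M} {ε : ℝ}
    (hφ : φ ∈ IsManifold.maximalAtlas (𝓡 4) ∞ M)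
    (hZ : ∀ x ∈ φ.source, x ∈ range (fun n : (Metric.sphere (0 : (EuclideanSpace ℝ (Fin 4))) 1) => e n) ↔ φ x 0 = 0)
    (hUo : IsOpen U) (hUs : U ⊆ φ.source) (hε : ε = 1 ∨ ε = -1)
    (hsgn : ∀ y ∈ U, (0 < ε * φ y 0 → y ∉ e '' closedBall (0 : (EuclideanSpace ℝ (Fin 4))) 1) ∧
      (ε * φ y 0 < 0 → y ∈ e '' ball (0 : (EuclideanSpace ℝ (Fin 4))) 1))
    {φ' : OpenPartialHomeomorph M (EuclideanSpace ℝ (Fin 4))} {ψ' : OpenPartialHomeomorph (EuclideanSpace ℝ (Fin 4)) (EuclideanSpace ℝ (Fin 4))} {U' : Set M} {ε' : ℝ}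
    (hφ' : φ' ∈ IsManifold.maximalAtlas (𝓡 4) ∞ M)
    (hψ' : ψ' ∈ IsManifold.maximalAtlas (𝓡 4) ∞ (EuclideanSpace ℝ (Fin 4))) (hsrc' : φ'.source ⊆ f ⁻¹' ψ'.source)
    (hnf' : ∀ x ∈ φ'.source, ψ' (f x) = φ' x + ((φ' x 0) ^ 2 - φ' x 0) •
      EuclideanSpace.single (0 : Fin 4) (1 : ℝ))
    (hZ' : ∀ x ∈ φ'.source, x ∈ range (fun n : (Metric.sphere (0 : (EuclideanSpace ℝ (Fin 4))) 1) => e n) ↔ φ' x 0 = 0)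
    (hUo' : IsOpen U') (hUs' : U' ⊆ φ'.source) (hε' : ε' = 1 ∨ ε' = -1)
    (hsgn' : ∀ y ∈ U', (0 < ε' * φ' y 0 → y ∉ e '' closedBall (0 : (EuclideanSpace ℝ (Fin 4))) 1) ∧
      (ε' * φ' y 0 < 0 → y ∈ e '' ball (0 : (EuclideanSpace ℝ (Fin 4))) 1))
    {x : M} (hxS : x ∈ range (fun n : (Metric.sphere (0 : (EuclideanSpace ℝ (Fin 4))) 1) => e n)) (hxU : x ∈ U) (hxU' : x ∈ U')
    {v : TangentSpace (𝓡 4) x} (hv0 : v ≠ 0)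
    (hφv : mfderiv (𝓡 4) (𝓡 4) φ x v = EuclideanSpace.single (0 : Fin 4) (1 : ℝ))
    (hdfv : mfderiv (𝓡 4) (𝓡 4) f x v = 0) :
    ∃ D : ℝ, HasDerivAt (fun t : ℝ => ε' * φ' (φ.symm (φ x +
        t • EuclideanSpace.single (0 : Fin 4) (1 : ℝ))) 0) D 0 ∧ 0 < ε * D := by
  have hx : x ∈ φ.source := hUs hxU
  have hx' : x ∈ φ'.source := hUs' hxU'
  have hx0 : φ x 0 = 0 := (hZ x hx).1 hxS
  have hx0' : φ' x 0 = 0 := (hZ' x hx').1 hxS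
  -- the derivative of `g = ε' (φ')₀` at `x`
  have hmd' := mdifferentiable_of_mem_maximalAtlas' hφ'
  set L' := hmd'.mfderiv hx' with hL'_def
  have hL' : ∀ z, L' z = mfderiv (𝓡 4) (𝓡 4) φ' x z := fun z => rfl
  set π₀ : (EuclideanSpace ℝ (Fin 4)) →L[ℝ] ℝ := EuclideanSpace.proj (0 : Fin 4) with hπ₀
  have hφ'd : HasMFDerivAt (𝓡 4) (𝓡 4) φ' x (mfderiv (𝓡 4) (𝓡 4) φ' x) :=
    (hmd'.mdifferentiableAt hx').hasMFDerivAt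
  have hπd : HasMFDerivAt 𝓘(ℝ, (EuclideanSpace ℝ (Fin 4))) 𝓘(ℝ, ℝ) π₀ (φ' x) π₀ := π₀.hasMFDerivAt
  have hgd : HasMFDerivAt (𝓡 4) 𝓘(ℝ, ℝ) (ε' • (π₀ ∘ φ')) x
      (ε' • π₀.comp (mfderiv (𝓡 4) (𝓡 4) φ' x)) := (hπd.comp x hφ'd).const_smul ε'
  set D : ℝ := ε' * π₀ (mfderiv (𝓡 4) (𝓡 4) φ' x v) with hD
  have hder := hasDerivAt_comp_chartLine hφ hx hφv hgd
  have hderD : HasDerivAt (fun t : ℝ => ε' * φ' (φ.symm (φ x +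
      t • EuclideanSpace.single (0 : Fin 4) (1 : ℝ))) 0) D 0 := by
    refine (hder.congr_deriv ?_).congr_of_eventuallyEq (Filter.Eventually.of_forall fun t => ?_)
    · rfl
    · rfl
  refine ⟨D, hderD, ?_⟩
  -- `D ≠ 0`: `dφ' v` is a non-zero multiple of `e₀`
  have hDne : D ≠ 0 := by
    obtain ⟨a, ha⟩ := mfderiv_chart_eq_smul_single_of_foldChart hφ' hψ' hsrc' hnf' hx' hx0' hdfv
    have hane : a ≠ 0 := by
      intro ha0
      rw [ha0, zero_smul] at ha
      have h1 : L' v = 0 := by rw [hL']; exact ha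
      exact hv0 (L'.injective (h1.trans (map_zero L').symm))
    have hπ : π₀ (mfderiv (𝓡 4) (𝓡 4) φ' x v) = a := by
      rw [ha]
      simp [hπ₀]
    have hε'ne : ε' ≠ 0 := by rcases hε' with h | h <;> simp [h]
    rw [hD, hπ]
    exact mul_ne_zero hε'ne hane
  -- `0 ≤ ε D`: one-sided Fermat along the chart line
  set k : ℝ → ℝ := fun t => ε * (ε' * φ' (φ.symm (φ x +
      t • EuclideanSpace.single (0 : Fin 4) (1 : ℝ))) 0) with hk
  have hkd : HasDerivAt k (ε * D) 0 := hderD.const_mul ε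
  have hk0 : k 0 = 0 := by
    simp only [hk, zero_smul, add_zero, φ.left_inv hx, hx0', mul_zero]
  have hev := eventually_chartLine_mem hx (hUo.inter hUo') ⟨hxU, hxU'⟩
  have hmin : IsLocalMinOn k (Ici 0) 0 := by
    have hev' : ∀ᶠ t : ℝ in 𝓝[Ici 0] 0, (φ x + t • EuclideanSpace.single (0 : Fin 4) (1 : ℝ) ∈
        φ.target ∧ φ.symm (φ x + t • EuclideanSpace.single (0 : Fin 4) (1 : ℝ)) ∈ U ∩ U') ∧
          t ∈ Ici (0 : ℝ) :=
      (hev.filter_mono nhdsWithin_le_nhds).and self_mem_nhdsWithin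
    refine hev'.mono fun t ht => ?_
    obtain ⟨⟨htgt, hyU, hyU'⟩, ht0⟩ := ht
    rw [hk0]
    set y := φ.symm (φ x + t • EuclideanSpace.single (0 : Fin 4) (1 : ℝ)) with hy
    have hφy : φ y 0 = t := by
      rw [hy, φ.right_inv htgt]
      simp [hx0]
    rcases (mem_Ici.1 ht0).lt_or_eq with htpos | ht00
    · -- `t > 0`: the point `y` is outside (ε = 1) or inside (ε = -1)
      show 0 ≤ ε * (ε' * φ' y 0)
      rcases hε with h1 | h1
      · have hout : y ∉ e '' closedBall (0 : (EuclideanSpace ℝ (Fin 4))) 1 :=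
          (hsgn y hyU).1 (by rw [h1, hφy, one_mul]; exact htpos)
        have hge : 0 ≤ ε' * φ' y 0 := by
          by_contra hlt
          push Not at hlt
          exact hout (image_mono ball_subset_closedBall ((hsgn' y hyU').2 hlt))
        rw [h1, one_mul]
        exact hge
      · have hin : y ∈ e '' ball (0 : (EuclideanSpace ℝ (Fin 4))) 1 :=
          (hsgn y hyU).2 (by rw [h1, hφy]; linarith)
        have hle : ε' * φ' y 0 ≤ 0 := by
          by_contra hlt
          push Not at hlt
          exact (hsgn' y hyU').1 hlt (image_mono ball_subset_closedBall hin)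
        rw [h1]
        linarith
    · -- `t = 0`
      rw [← ht00] at hy
      have hyx : y = x := by rw [hy, zero_smul, add_zero, φ.left_inv hx]
      show 0 ≤ ε * (ε' * φ' y 0)
      rw [hyx, hx0', mul_zero, mul_zero]
  have hcone : (1 : ℝ) ∈ posTangentConeAt (Ici (0 : ℝ)) 0 := by
    refine mem_posTangentConeAt_of_segment_subset ?_
    rw [zero_add, segment_eq_Icc zero_le_one]
    exact Icc_subset_Ici_self
  have hnonneg : 0 ≤ ε * D := by
    have h := hmin.hasFDerivWithinAt_nonneg hkd.hasFDerivAt.hasFDerivWithinAt hcone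
    simpa using h
  exact lt_of_le_of_ne hnonneg (by
    have hεne : ε ≠ 0 := by rcases hε with h | h <;> simp [h]
    exact (mul_ne_zero hεne hDne).symm)

/-! ### The lift `(f, λ)` is an immersion -/

/-- **A fold map along a chart sphere lifts to an immersion into `ℝ⁴ × ℝ`** (Gromov, PDR
§2.1.3 (C″), p. 58, for the fold maps of `eliashberg_foldMap_homotopySphere_four`). Let
`e : ℝ⁴ → M` be continuous, injective and open, and `f : M → ℝ⁴` smooth, with injective
differential off `Σ = e(S³)` and Gromov's fold normal form at every point of `Σ`. Then there is
a smooth `λ : M → ℝ` such that `F = (f, λ) : M → ℝ⁴ × ℝ` has injective differential at every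
point. Construction: `λ = Σᵢ ρᵢ · εᵢ (φᵢ)₀` for a smooth partition of unity subordinate to the
signed fold charts (`exists_signedFoldChart`) and `M ∖ Σ`. At a fold point `x`, `ker df_x` is the
line spanned by the chart kernel vector `v` (`eq_smul_kernel_of_foldChart`), and
`dλ_x(v) = Σᵢ ρᵢ(x) Dᵢ` with all `ε Dᵢ > 0` (`sign_consistency_of_signedFoldCharts`), so
`dλ_x(v) ≠ 0` and `ker dF_x = 0`. [cite: Gromov1986, §2.1.3 (C″) p. 58] -/
theorem exists_immersion_prodReal_of_foldMap [T2Space M] [SecondCountableTopology M]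
    {e : (EuclideanSpace ℝ (Fin 4)) → M} (hec : Continuous e) (heinj : Injective e)
    (heo : IsOpenMap e) {f : M → EuclideanSpace ℝ (Fin 4)} (hf : ContMDiff (𝓡 4) (𝓡 4) ∞ f)
    (hreg : ∀ x, x ∉ range (fun n : (Metric.sphere (0 : EuclideanSpace ℝ (Fin 4)) 1) => e n) →
      Injective (mfderiv (𝓡 4) (𝓡 4) f x))
    (hfold : ∀ n : (Metric.sphere (0 : EuclideanSpace ℝ (Fin 4)) 1),
      ∃ (φ : OpenPartialHomeomorph M (EuclideanSpace ℝ (Fin 4)))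
        (ψ : OpenPartialHomeomorph (EuclideanSpace ℝ (Fin 4)) (EuclideanSpace ℝ (Fin 4))),
        e n ∈ φ.source ∧ φ ∈ IsManifold.maximalAtlas (𝓡 4) ∞ M ∧
        ψ ∈ IsManifold.maximalAtlas (𝓡 4) ∞ (EuclideanSpace ℝ (Fin 4)) ∧
        φ.source ⊆ f ⁻¹' ψ.source ∧
        (∀ x ∈ φ.source, ψ (f x) = φ x + ((φ x 0) ^ 2 - φ x 0) •
          EuclideanSpace.single (0 : Fin 4) (1 : ℝ)) ∧
        (∀ x ∈ φ.source,
          x ∈ range (fun n : (Metric.sphere (0 : EuclideanSpace ℝ (Fin 4)) 1) => e n) ↔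
            φ x 0 = 0)) :
    ∃ F : M → (EuclideanSpace ℝ (Fin 4)) × ℝ,
      ContMDiff (𝓡 4) ((𝓡 4).prod 𝓘(ℝ, ℝ)) ∞ F ∧
      ∀ x, Injective (mfderiv (𝓡 4) ((𝓡 4).prod 𝓘(ℝ, ℝ)) F x) := by
  haveI : LocallyCompactSpace M := ChartedSpace.locallyCompactSpace (EuclideanSpace ℝ (Fin 4)) M
  haveI : SigmaCompactSpace M := sigmaCompactSpace_of_locallyCompact_secondCountable
  -- signed fold charts at every point of the sphere
  choose φ ψ U ε hφ hψ hsrc hnf hZ hUo hnU hUs hε hsgn using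
    fun n : (Metric.sphere (0 : EuclideanSpace ℝ (Fin 4)) 1) =>
      exists_signedFoldChart hec heinj heo n (hfold n)
  -- the fold locus and the cover by signed fold charts and its complement
  set Sg : Set M := range (fun n : (Metric.sphere (0 : EuclideanSpace ℝ (Fin 4)) 1) => e n)
    with hSg
  have hSgc : IsClosed Sg := (isCompact_range (hec.comp continuous_subtype_val)).isClosed
  set V : Option (Metric.sphere (0 : EuclideanSpace ℝ (Fin 4)) 1) → Set M :=
    fun i => i.elim Sgᶜ U with hV
  have hVo : ∀ i, IsOpen (V i) := by
    rintro (_ | n)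
    · exact hSgc.isOpen_compl
    · exact hUo n
  have hVcov : univ ⊆ ⋃ i, V i := by
    intro x _
    by_cases hx : x ∈ Sg
    · obtain ⟨n, rfl⟩ := hx
      exact mem_iUnion.2 ⟨some n, hnU n⟩
    · exact mem_iUnion.2 ⟨none, hx⟩
  obtain ⟨ρ, hρ⟩ := SmoothPartitionOfUnity.exists_isSubordinate (𝓡 4) isClosed_univ V hVo hVcov
  -- the local functions `εᵢ (φᵢ)₀` and the global `λ`
  set g : Option (Metric.sphere (0 : EuclideanSpace ℝ (Fin 4)) 1) → M → ℝ :=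
    fun i y => i.elim 0 (fun n => ε n * φ n y 0) with hg
  set lam : M → ℝ := fun y => ∑ᶠ i, ρ i y • g i y with hlam
  have hg_smooth : ∀ i, ContMDiffOn (𝓡 4) 𝓘(ℝ, ℝ) ∞ (g i) (V i) := by
    rintro (_ | n)
    · exact contMDiffOn_const
    · have h1 : ContMDiffOn (𝓡 4) (𝓡 4) ∞ (φ n) (φ n).source :=
        contMDiffOn_of_mem_maximalAtlas (hφ n)
      have h2 : ContMDiff (𝓡 4) 𝓘(ℝ, ℝ) ∞ (fun u : EuclideanSpace ℝ (Fin 4) => u 0) :=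
        (EuclideanSpace.proj (0 : Fin 4) : EuclideanSpace ℝ (Fin 4) →L[ℝ] ℝ).contMDiff
      have h3 : ContMDiffOn (𝓡 4) 𝓘(ℝ, ℝ) ∞ (fun y => φ n y 0) (U n) :=
        (h2.comp_contMDiffOn h1).mono (hUs n)
      exact contMDiffOn_const.mul h3
  have hlam_smooth : ContMDiff (𝓡 4) 𝓘(ℝ, ℝ) ∞ lam := hρ.contMDiff_finsum_smul hVo hg_smooth
  refine ⟨fun y => (f y, lam y), hf.prodMk hlam_smooth, fun x => ?_⟩
  rw [mfderiv_prodMk (hf.mdifferentiableAt (by simp)) (hlam_smooth.mdifferentiableAt (by simp))]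
  intro w₁ w₂ hw
  rw [← sub_eq_zero]
  have hw0 : ((mfderiv (𝓡 4) (𝓡 4) f x).prod (mfderiv (𝓡 4) 𝓘(ℝ, ℝ) lam x)) (w₁ - w₂) = 0 := by
    rw [map_sub, sub_eq_zero]
    exact hw
  have hfw : mfderiv (𝓡 4) (𝓡 4) f x (w₁ - w₂) = 0 := congrArg Prod.fst hw0
  have hlw : mfderiv (𝓡 4) 𝓘(ℝ, ℝ) lam x (w₁ - w₂) = 0 := congrArg Prod.snd hw0
  by_cases hxS : x ∈ Sg
  swap
  · exact hreg x hxS (hfw.trans (map_zero _).symm)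
  -- the fold point `x = e n`: the kernel of `df` is the line `ℝ v`, and `dλ v ≠ 0`
  obtain ⟨n, rfl⟩ := hxS
  have hxU : e n ∈ U n := hnU n
  have hx : e n ∈ (φ n).source := hUs n hxU
  have hx0 : φ n (e n) 0 = 0 := (hZ n _ hx).1 ⟨n, rfl⟩
  obtain ⟨v, hv0, hφv, hdfv, -⟩ := exists_kernel_of_foldChart (hφ n) (hψ n) (hsrc n) (hnf n) hx hx0
  -- derivative of `λ` along the chart line of `φ n`
  have hlamd : HasMFDerivAt (𝓡 4) 𝓘(ℝ, ℝ) lam (e n) (mfderiv (𝓡 4) 𝓘(ℝ, ℝ) lam (e n)) :=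
    (hlam_smooth.mdifferentiableAt (by simp)).hasMFDerivAt
  have hD0 := hasDerivAt_comp_chartLine (hφ n) hx hφv hlamd
  -- near `e n`, `λ` is a finite sum over `I = fintsupport ρ (e n)`
  set I := ρ.fintsupport (e n) with hI
  have hfin : ∀ᶠ y in 𝓝 (e n), lam y = ∑ i ∈ I, ρ i y • g i y := by
    filter_upwards [ρ.eventually_fintsupport_subset (e n)] with y hy
    apply finsum_eq_sum_of_support_subset
    intro i hi
    have h1 : ρ i y ≠ 0 := left_ne_zero_of_smul hi
    exact hy (ρ.finsupport_subset_fintsupport y ((ρ.mem_finsupport y).2 h1))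
  -- the chart line `γ`
  set γ : ℝ → M := fun t => (φ n).symm (φ n (e n) +
    t • EuclideanSpace.single (0 : Fin 4) (1 : ℝ)) with hγ
  have hγ0 : γ 0 = e n := by simp [hγ, (φ n).left_inv hx]
  have hγt : Filter.Tendsto γ (𝓝 0) (𝓝 (e n)) := by
    have hc : Continuous fun t : ℝ => φ n (e n) + t • EuclideanSpace.single (0 : Fin 4) (1 : ℝ) :=
      continuous_const.add (continuous_id.smul continuous_const)
    have h1 : ContinuousAt (φ n).symm (φ n (e n)) :=
      (φ n).continuousOn_symm.continuousAt ((φ n).open_target.mem_nhds ((φ n).map_source hx))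
    have h2 := h1.tendsto.comp (by simpa using hc.tendsto 0)
    rwa [(φ n).left_inv hx] at h2
  have hfinγ : ∀ᶠ t in 𝓝 (0 : ℝ), lam (γ t) = ∑ i ∈ I, ρ i (γ t) • g i (γ t) :=
    hγt.eventually hfin
  -- derivative of each local function along `γ`, with the sign of `ε n`
  have hIc : ∀ i ∈ I, ∃ c : ℝ, HasDerivAt (fun t => g i (γ t)) c 0 ∧ 0 < ε n * c := by
    intro i hi
    have hts : e n ∈ tsupport (ρ i) := (ρ.mem_fintsupport_iff _ i).1 hi
    rcases i with _ | m
    · exact absurd ⟨n, rfl⟩ (hρ none hts)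
    · have hxUm : e n ∈ U m := hρ (some m) hts
      obtain ⟨D, hD, hpos⟩ := sign_consistency_of_signedFoldCharts (hφ n) (hZ n) (hUo n) (hUs n)
        (hε n) (hsgn n) (hφ m) (hψ m) (hsrc m) (hnf m) (hZ m) (hUo m) (hUs m) (hε m) (hsgn m)
        ⟨n, rfl⟩ hxU hxUm hv0 hφv hdfv
      exact ⟨D, hD, hpos⟩
  choose! c hc hcpos using hIc
  have hρd : ∀ i, HasDerivAt (fun t => ρ i (γ t)) (mfderiv (𝓡 4) 𝓘(ℝ, ℝ) (ρ i) (e n) v) 0 :=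
    fun i => hasDerivAt_comp_chartLine (hφ n) hx hφv
      (((ρ i).contMDiff.mdifferentiableAt (by simp)).hasMFDerivAt)
  have hg0 : ∀ i ∈ I, g i (γ 0) = 0 := by
    intro i hi
    rw [hγ0]
    have hts : e n ∈ tsupport (ρ i) := (ρ.mem_fintsupport_iff _ i).1 hi
    rcases i with _ | m
    · rfl
    · have hxm : e n ∈ (φ m).source := hUs m (hρ (some m) hts)
      show ε m * φ m (e n) 0 = 0
      rw [(hZ m _ hxm).1 ⟨n, rfl⟩, mul_zero]
  have hsum : HasDerivAt (fun t => ∑ i ∈ I, ρ i (γ t) • g i (γ t))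
      (∑ i ∈ I, ρ i (e n) * c i) 0 := by
    refine HasDerivAt.fun_sum fun i hi => ?_
    have h1 := (hρd i).fun_mul (hc i hi)
    rw [hg0 i hi, mul_zero, zero_add, hγ0] at h1
    exact h1
  have hD1 : HasDerivAt (fun t => lam (γ t)) (∑ i ∈ I, ρ i (e n) * c i) 0 :=
    hsum.congr_of_eventuallyEq hfinγ
  have heq : mfderiv (𝓡 4) 𝓘(ℝ, ℝ) lam (e n) v = ∑ i ∈ I, ρ i (e n) * c i := hD0.unique hD1
  have hpos : 0 < ε n * ∑ i ∈ I, ρ i (e n) * c i := by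
    rw [Finset.mul_sum]
    apply Finset.sum_pos'
    · intro i hi
      have h1 := hcpos i hi
      calc (0 : ℝ) ≤ ρ i (e n) * (ε n * c i) := mul_nonneg (ρ.nonneg i (e n)) h1.le
        _ = ε n * (ρ i (e n) * c i) := by ring
    · obtain ⟨i, hi⟩ := ρ.exists_pos_of_mem (mem_univ (e n))
      have hiI : i ∈ I :=
        ρ.finsupport_subset_fintsupport _ ((ρ.mem_finsupport (e n)).2 hi.ne')
      refine ⟨i, hiI, ?_⟩
      calc (0 : ℝ) < ρ i (e n) * (ε n * c i) := mul_pos hi (hcpos i hiI)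
        _ = ε n * (ρ i (e n) * c i) := by ring
  have hkey : mfderiv (𝓡 4) 𝓘(ℝ, ℝ) lam (e n) v ≠ 0 := by
    intro h0
    have h0' : ∑ i ∈ I, ρ i (e n) * c i = (0 : ℝ) := by
      rw [← heq]
      exact h0
    rw [h0', mul_zero] at hpos
    exact lt_irrefl 0 hpos
  -- conclude: `w₁ - w₂ = a • v` and `a dλ(v) = 0`
  obtain ⟨a, ha⟩ := eq_smul_kernel_of_foldChart (hφ n) (hψ n) (hsrc n) (hnf n) hx hx0 hφv hfw
  have hS : (∑ i ∈ I, ρ i (e n) * c i) ≠ 0 := fun h0 => hkey (heq.trans h0)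
  have h1 : a * ∑ i ∈ I, ρ i (e n) * c i = 0 := by
    rw [ha, ContinuousLinearMap.map_smul, heq] at hlw
    exact hlw
  have ha0 : a = 0 := (mul_eq_zero.1 h1).resolve_right hS
  rw [ha, ha0, zero_smul]

/-- **An open smooth embedding of `ℝ⁴`.** A `C^∞` map `e : ℝ⁴ → M⁴` with everywhere injective
differential is a local diffeomorphism (inverse function theorem,
`Literature.Topology.FourManifolds.isLocalDiffeomorphAt_of_mfderiv_injective`), hence an open
map. [folklore] -/
theorem isOpenMap_of_injective_mfderiv {e : (EuclideanSpace ℝ (Fin 4)) → M}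
    (he : ContMDiff (𝓡 4) (𝓡 4) ∞ e)
    (hde : ∀ y, Injective (mfderiv (𝓡 4) (𝓡 4) e y)) : IsOpenMap e := by
  have h : IsLocalDiffeomorph (𝓡 4) (𝓡 4) ∞ e := fun y =>
    Literature.Topology.FourManifolds.isLocalDiffeomorphAt_of_mfderiv_injective isOpen_univ
      (mem_univ y) he.contMDiffOn (by exact_mod_cast le_top) rfl (hde y)
  exact h.isOpenMap

/-- **`eliashberg_foldMap_homotopySphere_four` ⟹ every smooth homotopy 4-sphere immerses in
`ℝ⁴ × ℝ = ℝ⁵`.** The named fact (Eliashberg's folding theorem, instance: a fold map `M → ℝ⁴`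
along a chart 3-sphere on every homotopy 4-sphere) implies, by the lift
`exists_immersion_prodReal_of_foldMap`, a smooth map `M → ℝ⁴ × ℝ` with everywhere injective
differential. Since `M` is simply connected the normal line bundle of such an immersion is
trivial, so `TM ⊕ ℝ` is trivial: the fact carries Kervaire–Milnor's Thm. 3.1 for `n = 4`
(s-parallelisability of homotopy 4-spheres; signature theorem), an open leaf of the tree.
[cite: Gromov1986, §2.1.3 (C″) p. 58 and (D) p. 59] -/
theorem exists_immersion_prodReal_of_eliashbergFoldMap
    (h : Literature.Topology.FourManifolds.eliashberg_foldMap_homotopySphere_four)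
    (N : Type) [TopologicalSpace N] [T2Space N] [SecondCountableTopology N]
    [ChartedSpace (EuclideanSpace ℝ (Fin 4)) N] [IsManifold (𝓡 4) ∞ N]
    (hN : ContinuousMap.HomotopyEquiv N (Metric.sphere (0 : EuclideanSpace ℝ (Fin 5)) 1)) :
    ∃ F : N → (EuclideanSpace ℝ (Fin 4)) × ℝ,
      ContMDiff (𝓡 4) ((𝓡 4).prod 𝓘(ℝ, ℝ)) ∞ F ∧
      ∀ x, Injective (mfderiv (𝓡 4) ((𝓡 4).prod 𝓘(ℝ, ℝ)) F x) := by
  obtain ⟨e, f, he, hemb, hde, hf, hreg, hfold⟩ := h N hN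
  exact exists_immersion_prodReal_of_foldMap he.continuous hemb.injective
    (isOpenMap_of_injective_mfderiv he hde) hf hreg hfold

/-- **The same over the tree's `HomotopySphere 4`** (the carrier type of
`Literature.Topology.FourManifolds.HomotopySphere`, the quantifier of the open hypothesis
`h31 : ∀ S : HomotopySphere 4, IsStablyParallelizable (𝓡 4) S.carrier` of
`Literature.Barriers.SmoothPoincare4.stableBarrierFour_of_kervaireMilnorFrontier`): granted the
named fact, every `S : HomotopySphere 4` immerses in `ℝ⁴ × ℝ`.
[cite: Gromov1986, §2.1.3 (C″) p. 58 and (D) p. 59] -/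
theorem exists_immersion_prodReal_homotopySphere_of_eliashbergFoldMap
    (h : Literature.Topology.FourManifolds.eliashberg_foldMap_homotopySphere_four)
    (S : Literature.Topology.FourManifolds.HomotopySphere 4) :
    ∃ F : S.carrier → (EuclideanSpace ℝ (Fin 4)) × ℝ,
      ContMDiff (𝓡 4) ((𝓡 4).prod 𝓘(ℝ, ℝ)) ∞ F ∧
      ∀ x, Injective (mfderiv (𝓡 4) ((𝓡 4).prod 𝓘(ℝ, ℝ)) F x) := by
  obtain ⟨e⟩ := S.nonempty_homotopyEquiv
  exact exists_immersion_prodReal_of_eliashbergFoldMap h S.carrier e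

end Summit.SmoothPoincare4.SmoothPoincare4.Theorems.FoldedSphereFoldExistence

end
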